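import Literature.NumberTheory.EllipticCurves.FourTorsionHalvingProofs
import Literature.NumberTheory.EllipticCurves.TwoAdicImageModFourArithmeticProofs
import HarnessLib

/-!
# The four resolvent classes of `K(E[4])` and their Galois cocycle (proofs only)

Sorry-free `Proofs` companion (bookkeeping definitions and theorems; no named fact, no instance;
D-0014/D-0026) — the second of three files turning clause (2) of
T. Dokchitser, V. Dokchitser, *Surjectivity of mod `2ⁿ` representations of elliptic curves*,
Math. Z. 272 (2012) 961–964, Theorem, into a kernel theorem (the LEMMA of loc. cit., p. 962).
For an elliptic curve `E/K`, `char K ≠ 2`, in the frame `E[4] ≅ (ℤ/4)²` of `LevelFour.frame4`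
(basis `P₀, Q₀`):

* §1 the three HALVES `H_i = frame⁻¹(w_i)`, `w = (δ₀, δ₁, δ₀ + δ₁)`, of the `2`-torsion points
  `L_i = 2H_i`, and `v_i := x(H_i) - x(L_i)` with `4v_i² = u′(x(L_i))` (file `FourTorsionHalving…`);
* §2 the permutation `π_σ` of the indices (`σL_i = L_{π_σ i}`; through the letters of
  `TwoTorsionGaloisActionProofs`) and the signs `s_σ(i) ∈ ℤ/2` (`σH_i = ±H_{π_σ i}` or not, read
  off the matrix `ρ̄₄(σ)`), with the COCYCLE `σ v_i = (-1)^{s_σ(i)} v_{π_σ i}` (`smul_v`);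
* §3 the four numbers `w_η = Σ_k (-1)^{η_k} v_{k+1} v_{k+2}` indexed by the even sign classes
  `η ∈ (ℤ/2)²` (`η₂ = η₀ + η₁`), the explicit action `actE π s` of a pair `(π, s)` on the classes,
  and `σ w_η = w_{actE π_σ s_σ η}` (`smul_w`); kernel-decidable facts about `actE` (a pair with a
  fixed-point-free `π` fixes EXACTLY ONE class, and so does its square; `(1, const)` acts
  trivially);
* §4 the dictionary with the matrices: `π_σ i = i ⟺` the parity of `ρ̄₄(σ)` fixes `w̄_i`
  (`pi_apply_eq_iff`), hence `π_σ = 1 ⟺ ρ̄₄(σ) ≡ 1 (mod 2)`, and `π_σ` has no fixed index iff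
  `ρ̄₄(σ) mod 2` is a `3`-cycle; the matrices `±1, ±(1 + 2w₀)` act trivially on the classes
  (`actE_eq_self_of_tup_mem_four`); and `diag(3, 1)` moves every class (`actE_diag_ne_self`).

These are the Galois-theoretic facts behind Dokchitser–Dokchitser's resolvent: the four `w_η`
play the role of their `θ_C` (one per coset `C` of `ℍ`), and `∏_η (X - w_η)` is their quartic up to
an affine substitution (file `TwoAdicImageSurjectivityModFourProofs`, where the LEMMA is proved).

## References

* [DokchitserDokchitserMathZ2012] T. Dokchitser, V. Dokchitser, Math. Z. 272 (2012) 961–964,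
  Lemma (p. 962) and its proof ("for `h ∈ Gal(K(E[4])/K) ⊂ GL₂(ℤ/4ℤ)` we have
  `h(θ_C) = θ_{hC}`"). [corpus:paper:arxiv-1104.5031 p0001 L109–L171, p0002 L1–L12]
* [SilvermanAEC2009] J. H. Silverman, *The Arithmetic of Elliptic Curves*, 2nd ed., GTM 106
  (2009), III.6.4 (b), III.7, VIII.1.
-/

set_option autoImplicit false

/-! ### §0. Sign classes: kernel-decidable bookkeeping on `(ℤ/2)²` and `S₃` -/

namespace Literature.NumberTheory.EllipticCurves.DokchitserDokchitser2012.LevelFour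

/-- The full sign vector `(η₀, η₁, η₀ + η₁)` of a class `η ∈ (ℤ/2)²` (bookkeeping). [folklore] -/
def etaf (η : ZMod 2 × ZMod 2) : Fin 3 → ZMod 2 := ![η.1, η.2, η.1 + η.2]

/-- The action of a pair `(π, s)` (index permutation, signs) on the sign classes: the new sign at
position `π k` is `η_k + s_k + (s₀ + s₁ + s₂)` (bookkeeping). [folklore] -/
def actE (π : Equiv.Perm (Fin 3)) (s : Fin 3 → ZMod 2) (η : ZMod 2 × ZMod 2) : ZMod 2 × ZMod 2 :=
  (etaf η (π.symm 0) + s (π.symm 0) + (s 0 + s 1 + s 2),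
    etaf η (π.symm 1) + s (π.symm 1) + (s 0 + s 1 + s 2))

set_option synthInstance.maxSize 2048 in
set_option maxRecDepth 100000 in
set_option maxHeartbeats 0 in
/-- The new sign at position `π k` is `η_k + s_{k+1} + s_{k+2}` (bookkeeping for the action of
`GL₂(ℤ/4ℤ)` on the four classes). [cite: DokchitserDokchitserMathZ2012, Lemma (p. 962), proof (h ↦ θ_{hC} is a transitive action of GL₂(ℤ/4ℤ))] -/
theorem etaf_actE : ∀ (π : Equiv.Perm (Fin 3)) (s : Fin 3 → ZMod 2) (η : ZMod 2 × ZMod 2)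
    (k : Fin 3), etaf (actE π s η) (π k) = etaf η k + s (k + 1) + s (k + 2) := by
  decide +kernel

set_option synthInstance.maxSize 2048 in
set_option maxRecDepth 100000 in
set_option maxHeartbeats 0 in
/-- A pair `(π, s)` with fixed-point-free `π` fixes exactly one class, and so does its square (the
elements of order `3` of `S₄` acting on the four `θ_C`). [cite: DokchitserDokchitserMathZ2012, Lemma (p. 962), proof (the stabilisers of the θ_C are the conjugates of ℍ)] -/
theorem actE_existsUnique_fixed : ∀ (π : Equiv.Perm (Fin 3)), (∀ k, π k ≠ k) →
    ∀ s : Fin 3 → ZMod 2, ∃ η₀ : ZMod 2 × ZMod 2, ∀ η : ZMod 2 × ZMod 2,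
      (actE π s η = η ↔ η = η₀) ∧ (actE π s (actE π s η) = η ↔ η = η₀) := by
  decide +kernel

set_option synthInstance.maxSize 2048 in
/-- `(1, const)` acts trivially on the classes. [folklore] -/
private theorem actE_one_const : ∀ (c : ZMod 2) (η : ZMod 2 × ZMod 2), actE 1 (fun _ ↦ c) η = η := by
  decide

set_option synthInstance.maxSize 2048 in
/-- `(1, (0, 0, 1))` moves every class (it adds `(1, 1)`). [folklore] -/
private theorem actE_one_single_ne : ∀ η : ZMod 2 × ZMod 2, actE 1 ![0, 0, 1] η ≠ η := by
  decide

set_option synthInstance.maxSize 2048 in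
/-- A permutation of three indices maps `{k+1, k+2}` onto `{πk + 1, πk + 2}`. [folklore] -/
private theorem perm_succ_cases : ∀ (π : Equiv.Perm (Fin 3)) (k : Fin 3),
    (π (k + 1) = π k + 1 ∧ π (k + 2) = π k + 2) ∨ (π (k + 1) = π k + 2 ∧ π (k + 2) = π k + 1) := by
  decide

set_option synthInstance.maxSize 2048 in
/-- In `S₃` a conjugate of a `3`-cycle `c` is `c` or `c²` (`A₃ ◁ S₃ ≅ GL₂(𝔽₂)`).
[cite: DokchitserDokchitserMathZ2012, proof of the Theorem (GL₂(𝔽₂) ≅ S₃)] -/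
theorem perm_conj_three_cycle : ∀ (c p : Equiv.Perm (Fin 3)), (∀ k, c k ≠ k) →
    p * c * p⁻¹ = c ∨ p * c * p⁻¹ = c * c := by
  decide

end Literature.NumberTheory.EllipticCurves.DokchitserDokchitser2012.LevelFour

noncomputable section

open scoped Classical

open Matrix WeierstrassCurve

namespace Literature.NumberTheory.EllipticCurves.DokchitserDokchitser2012

namespace LevelFour

open Literature.NumberTheory.GaloisRepresentations.GL2Mod8 (P4 P4.mul P4.det sgnUnit
  sgnUnit_zero sgnUnit_one sgnUnit_add)
open Literature.NumberTheory.GaloisRepresentations.GL2Mod4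

universe u

variable {K : Type u} [Field K] (W : WeierstrassCurve K) [W.IsElliptic] (h2 : (2 : K) ≠ 0)

/-! ### §1. The halves `H_i` of the `2`-torsion points `L_i` and `v_i = x(H_i) - x(L_i)` -/

/-- `H_i = e⁻¹(w_i) ∈ E[4]`: `H₀ = P₀`, `H₁ = Q₀`, `H₂ = P₀ + Q₀`, halves of `L_i = e⁻¹(2w_i)`
(bookkeeping). [folklore] -/
abbrev Hf (i : Fin 3) : geomTorsion W 4 := (frame4 W h2).symm (wvec i)

/-- `H_i + H_i = L_i` in `E(K̄)`. [cite: SilvermanAEC2009, Cor. III.6.4(b) (E[m] ≅ ℤ/mℤ × ℤ/mℤ)] -/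
theorem coe_Hf_add_self (i : Fin 3) :
    (Hf W h2 i : geomPoints W) + Hf W h2 i = ((L W h2 i : geomTorsion W 4) : geomPoints W) := by
  rw [← AddSubgroup.coe_add, ← map_add, ← two_nsmul]

/-- `L_i ≠ O` and `L_i + L_i = O` in `E(K̄)`. [cite: SilvermanAEC2009, Cor. III.6.4(b) (E[m] ≅ ℤ/mℤ × ℤ/mℤ)] -/
theorem coe_L_facts (i : Fin 3) :
    ((L W h2 i : geomTorsion W 4) : geomPoints W) ≠ 0 ∧
      ((L W h2 i : geomTorsion W 4) : geomPoints W) + ((L W h2 i : geomTorsion W 4) : geomPoints W)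
        = 0 :=
  ⟨(L_mem_two W (frame4 W h2) i).2, (mem_geomTorsion_two_iff W _).mp (L_mem_two W (frame4 W h2) i).1⟩

/-- `x(L_i) = e_{f i}`, the abscissa of the letter `T_{f i} = L_i`.
[cite: SilvermanAEC2009, Cor. III.6.4(b) (E[2] = {O, T₀, T₁, T₂})] -/
theorem xco_L (i : Fin 3) :
    xco W ((L W h2 i : geomTorsion W 4) : geomPoints W) = xT W h2 (letter W h2 i) := by
  rw [xT, coe_T_letter]

/-- `v_i := x(H_i) - x(L_i)`, "half the square root of `u_i`" (bookkeeping). [folklore] -/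
def v (i : Fin 3) : AlgebraicClosure K :=
  xco W (Hf W h2 i : geomPoints W) - xco W ((L W h2 i : geomTorsion W 4) : geomPoints W)

/-- **`4 v_i² = u_{f i}`** (`= 4(e - e′)(e - e″)` over the other two abscissae; the halving
identity of `FourTorsionHalvingProofs`). [cite: DokchitserDokchitserMathZ2012, Lemma (p. 962), proof (abscissae of the primitive 4-torsion points)] -/
theorem four_mul_v_sq (i : Fin 3) : 4 * v W h2 i ^ 2 = uT W h2 (letter W h2 i) := by
  rw [v, uT, four_mul_sq_xco_sub_eq W (coe_L_facts W h2 i).1 (coe_L_facts W h2 i).2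
    (coe_Hf_add_self W h2 i), xco_L]

/-- `v_i ≠ 0`. [cite: DokchitserDokchitserMathZ2012, Lemma (p. 962), proof (the θ_C are distinct)] -/
theorem v_ne_zero (i : Fin 3) : v W h2 i ≠ 0 := fun h ↦
  uT_ne_zero W h2 (letter W h2 i) (by rw [← four_mul_v_sq, h]; ring)

/-- `v_i ≠ ± v_j` for `i ≠ j`, as soon as every `T_k` is moved by `Γ_K` and `3 ≠ 0`
(`v_i² = v_j²` would give `u_{f i} = u_{f j}`). [cite: DokchitserDokchitserMathZ2012, Lemma (p. 962) (hypothesis b ≠ 0)] -/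
theorem v_add_ne_zero_and_sub_ne_zero (h3 : (3 : K) ≠ 0)
    (hmove : ∀ k : Fin 3, ∃ σ : Field.absoluteGaloisGroup K, σ • T W h2 k ≠ T W h2 k)
    {i j : Fin 3} (hij : i ≠ j) : v W h2 i + v W h2 j ≠ 0 ∧ v W h2 i - v W h2 j ≠ 0 := by
  obtain ⟨h01, h02, h12⟩ := uT_pairwise_ne W h2 h3 hmove
  have hu : uT W h2 (letter W h2 i) ≠ uT W h2 (letter W h2 j) := by
    have hl : letter W h2 i ≠ letter W h2 j := fun h ↦ hij (letter_injective W h2 h)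
    have key : ∀ a b : Fin 3, a ≠ b → uT W h2 a ≠ uT W h2 b := by
      intro a b hab
      fin_cases a <;> fin_cases b
      · exact absurd rfl hab
      · exact h01
      · exact h02
      · exact fun h ↦ h01 h.symm
      · exact absurd rfl hab
      · exact h12
      · exact fun h ↦ h02 h.symm
      · exact fun h ↦ h12 h.symm
      · exact absurd rfl hab
    exact key _ _ hl
  have hsq : v W h2 i ^ 2 ≠ v W h2 j ^ 2 := fun h ↦ hu (by rw [← four_mul_v_sq, ← four_mul_v_sq, h])
  constructor
  · intro h
    apply hsq
    have : v W h2 i = -v W h2 j := by linear_combination h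
    rw [this, neg_sq]
  · intro h
    apply hsq
    rw [sub_eq_zero.mp h]

/-! ### §2. The permutation `π_σ` and the signs `s_σ`; the cocycle `σ v_i = ± v_{π_σ i}` -/

/-- The letters `i ↦ f i` as a permutation (`L_i = T_{f i}`). [folklore] -/
def letterEquiv : Fin 3 ≃ Fin 3 :=
  Equiv.ofBijective (letter W h2) (letter_injective W h2).bijective_of_finite

/-- `π_σ`: the permutation of the indices with `σ L_i = L_{π_σ i}` (bookkeeping:
`f ∘ π_σ = permGal σ ∘ f`). [folklore] -/
def pi (σ : Field.absoluteGaloisGroup K) : Equiv.Perm (Fin 3) :=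
  ((letterEquiv W h2).trans (permGal W h2 σ)).trans (letterEquiv W h2).symm

/-- `f (π_σ i) = permGal σ (f i)`. [cite: SilvermanAEC2009, III.7 (the Galois action on E[2] ⊂ E[4])] -/
theorem letter_pi (σ : Field.absoluteGaloisGroup K) (i : Fin 3) :
    letter W h2 (pi W h2 σ i) = permGal W h2 σ (letter W h2 i) :=
  (letterEquiv W h2).apply_symm_apply _

/-- `π` is multiplicative. [cite: SilvermanAEC2009, III.7 (the representation G_{K̄/K} → Aut(E[m]))] -/
theorem pi_mul (σ τ : Field.absoluteGaloisGroup K) : pi W h2 (σ * τ) = pi W h2 σ * pi W h2 τ := by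
  refine Equiv.ext fun i ↦ letter_injective W h2 ?_
  rw [Equiv.Perm.mul_apply, letter_pi, letter_pi, letter_pi, permGal_mul, Equiv.Perm.mul_apply]

/-- `π_1 = 1`. [cite: SilvermanAEC2009, III.7 (the representation G_{K̄/K} → Aut(E[m]))] -/
theorem pi_one : pi W h2 1 = 1 := by
  refine Equiv.ext fun i ↦ letter_injective W h2 ?_
  rw [letter_pi, permGal_one, Equiv.Perm.one_apply, Equiv.Perm.one_apply]

/-- `π_{σ⁻¹} = π_σ⁻¹`. [cite: SilvermanAEC2009, III.7 (the representation G_{K̄/K} → Aut(E[m]))] -/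
theorem pi_inv (σ : Field.absoluteGaloisGroup K) : pi W h2 σ⁻¹ = (pi W h2 σ)⁻¹ :=
  eq_inv_of_mul_eq_one_left (by rw [← pi_mul, inv_mul_cancel, pi_one])

/-- **`σ L_i = L_{π_σ i}`** in `E(K̄)`. [cite: SilvermanAEC2009, III.7 (the Galois action on E[2] ⊂ E[4])] -/
theorem smul_coe_L (σ : Field.absoluteGaloisGroup K) (i : Fin 3) :
    σ • ((L W h2 i : geomTorsion W 4) : geomPoints W) =
      ((L W h2 (pi W h2 σ i) : geomTorsion W 4) : geomPoints W) := by
  rw [← coe_T_letter, ← coe_T_letter, ← coe_T_permGal, letter_pi]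

/-- `e(σ H_i) = ρ̄₄(σ) w_i`. [cite: SilvermanAEC2009, III.7 (the representation ρ̄_m on E[m])] -/
theorem frame4_smul_Hf (σ : Field.absoluteGaloisGroup K) (i : Fin 3) :
    frame4 W h2 (σ • Hf W h2 i) = M W h2 σ *ᵥ wvec i := by
  rw [rhoMat_mulVec, AddEquiv.apply_symm_apply]

/-- `σ H_i = H_j` iff `ρ̄₄(σ) w_i = w_j`, and `σ H_i = -H_j` iff `ρ̄₄(σ) w_i = -w_j` (in `E(K̄)`).
[cite: SilvermanAEC2009, III.7 (the representation ρ̄_m on E[m])] -/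
theorem smul_coe_Hf_eq_iff (σ : Field.absoluteGaloisGroup K) (i j : Fin 3) :
    (σ • (Hf W h2 i : geomPoints W) = Hf W h2 j ↔ M W h2 σ *ᵥ wvec i = wvec j) ∧
      (σ • (Hf W h2 i : geomPoints W) = -(Hf W h2 j : geomPoints W) ↔
        M W h2 σ *ᵥ wvec i = -wvec j) := by
  constructor
  · rw [← AddSubgroup.torsionBy.coe_smul, Subtype.coe_inj, ← (frame4 W h2).injective.eq_iff,
      frame4_smul_Hf, AddEquiv.apply_symm_apply]
  · rw [← AddSubgroup.torsionBy.coe_smul, ← AddSubgroup.coe_neg, Subtype.coe_inj,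
      ← (frame4 W h2).injective.eq_iff, frame4_smul_Hf, map_neg, AddEquiv.apply_symm_apply]

/-- `s_σ(i) ∈ ℤ/2`: `0` iff `σ H_i = ± H_{π_σ i}`, read off the matrix: `ρ̄₄(σ) w_i = ± w_{π_σ i}`
(bookkeeping). [folklore] -/
def sgnH (σ : Field.absoluteGaloisGroup K) (i : Fin 3) : ZMod 2 :=
  if M W h2 σ *ᵥ wvec i = wvec (pi W h2 σ i) ∨ M W h2 σ *ᵥ wvec i = -wvec (pi W h2 σ i)
  then 0 else 1

/-- **The cocycle: `σ v_i = (-1)^{s_σ(i)} v_{π_σ i}`.** `σH_i` is a half of `σL_i = L_{π_σ i}`,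
so its abscissa is `x(H_{π_σ i})` when `σH_i = ±H_{π_σ i}` and `2x(L_{π_σ i}) - x(H_{π_σ i})`
otherwise ("`h(θ_C) = θ_{hC}`": the Galois action on the abscissae of the `4`-torsion IS the
matrix action). [cite: DokchitserDokchitserMathZ2012, Lemma (p. 962), proof (h(θ_C) = θ_{hC})] -/
theorem smul_v (σ : Field.absoluteGaloisGroup K) (i : Fin 3) :
    σ • v W h2 i = (sgnUnit (sgnH W h2 σ i) : AlgebraicClosure K) * v W h2 (pi W h2 σ i) := by
  set j := pi W h2 σ i with hj
  obtain ⟨hL0, hLL⟩ := coe_L_facts W h2 j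
  have hQ : σ • (Hf W h2 i : geomPoints W) + σ • (Hf W h2 i : geomPoints W) =
      ((L W h2 j : geomTorsion W 4) : geomPoints W) := by
    rw [← smul_add, coe_Hf_add_self, smul_coe_L]
  have hH := coe_Hf_add_self W h2 j
  have hor := xco_eq_or_add_eq_of_halves W h2 hL0 hLL hQ hH
  have hiff := xco_eq_iff_of_halves W hL0 hQ hH
  obtain ⟨hc1, hc2⟩ := smul_coe_Hf_eq_iff W h2 σ i j
  rw [v, v, smul_sub, ← xco_smul, ← xco_smul, smul_coe_L, sgnH]
  by_cases hc : M W h2 σ *ᵥ wvec i = wvec (pi W h2 σ i) ∨ M W h2 σ *ᵥ wvec i = -wvec (pi W h2 σ i)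
  · rw [if_pos hc, sgnUnit_zero, Int.cast_one, one_mul, ← hj]
    rw [← hj, ← hc1, ← hc2, ← hiff] at hc
    rw [hc]
  · rw [if_neg hc, sgnUnit_one, Int.cast_neg, Int.cast_one, neg_one_mul, ← hj]
    rw [← hj, ← hc1, ← hc2, ← hiff] at hc
    linear_combination hor.resolve_left hc

/-! ### §3. The four classes `w_η` and `σ w_η = w_{actE π_σ s_σ η}` -/

/-- `p_k = v_{k+1} v_{k+2}`, the product of the other two `v`'s (bookkeeping). [folklore] -/
def pp (k : Fin 3) : AlgebraicClosure K := v W h2 (k + 1) * v W h2 (k + 2)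

/-- **The resolvent classes** `w_η = Σ_k (-1)^{η_k} v_{k+1} v_{k+2}`, `η ∈ (ℤ/2)²` extended by
`η₂ = η₀ + η₁` — one algebraic number per even sign class, Dokchitser–Dokchitser's `θ_C` in
invariant form (bookkeeping). [folklore] -/
def w (η : ZMod 2 × ZMod 2) : AlgebraicClosure K :=
  ∑ k : Fin 3, (sgnUnit (etaf η k) : AlgebraicClosure K) * pp W h2 k

/-- **`σ w_η = w_{actE π_σ s_σ η}`**: `Γ_K` permutes the four classes through the explicit pair
`(π_σ, s_σ)` ("`h(θ_C) = θ_{hC}`, and hence `∏_C (x - θ_C)` has coefficients in `K`").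
[cite: DokchitserDokchitserMathZ2012, Lemma (p. 962), proof (h(θ_C) = θ_{hC})] -/
theorem smul_w (σ : Field.absoluteGaloisGroup K) (η : ZMod 2 × ZMod 2) :
    σ • w W h2 η = w W h2 (actE (pi W h2 σ) (sgnH W h2 σ) η) := by
  have hint : ∀ z : ℤ, σ • ((z : ℤ) : AlgebraicClosure K) = z := fun z ↦
    map_intCast (show AlgebraicClosure K ≃ₐ[K] AlgebraicClosure K from σ) z
  simp only [w, pp, Finset.smul_sum, smul_mul', hint, smul_v]
  rw [← Equiv.sum_comp (pi W h2 σ) (fun k ↦ (sgnUnit (etaf (actE (pi W h2 σ) (sgnH W h2 σ) η) k) :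
    AlgebraicClosure K) * (v W h2 (k + 1) * v W h2 (k + 2)))]
  refine Finset.sum_congr rfl fun k _ ↦ ?_
  rw [etaf_actE, sgnUnit_add, sgnUnit_add]
  push_cast
  rcases perm_succ_cases (pi W h2 σ) k with ⟨h1, h2'⟩ | ⟨h1, h2'⟩ <;> rw [h1, h2'] <;> ring

/-- **The four classes are distinct** (`w_η - w_{η′} = ± 2 v_k (v_i ± v_j)`), as soon as every
`T_k` is moved by `Γ_K` and `3 ≠ 0` (Dokchitser–Dokchitser: `disc f = 3⁶b²Δ³ ≠ 0`, "so it has no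
repeated roots and the `θ_C` are distinct").
[cite: DokchitserDokchitserMathZ2012, Lemma (p. 962), proof (the θ_C are distinct)] -/
theorem w_injective (h3 : (3 : K) ≠ 0)
    (hmove : ∀ k : Fin 3, ∃ σ : Field.absoluteGaloisGroup K, σ • T W h2 k ≠ T W h2 k) :
    Function.Injective (w W h2) := by
  have h2' : (2 : AlgebraicClosure K) ≠ 0 := fun h0 ↦
    h2 ((algebraMap K (AlgebraicClosure K)).injective (by rw [map_ofNat, h0, map_zero]))
  have hv := v_ne_zero W h2
  have hpm := fun (i j : Fin 3) (hij : i ≠ j) ↦ v_add_ne_zero_and_sub_ne_zero W h2 h3 hmove hij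
  -- the six differences
  have d1 : 2 * v W h2 1 * (v W h2 2 + v W h2 0) ≠ 0 :=
    mul_ne_zero (mul_ne_zero h2' (hv 1)) (hpm 2 0 (by decide)).1
  have d2 : 2 * v W h2 0 * (v W h2 2 + v W h2 1) ≠ 0 :=
    mul_ne_zero (mul_ne_zero h2' (hv 0)) (hpm 2 1 (by decide)).1
  have d3 : 2 * v W h2 2 * (v W h2 1 + v W h2 0) ≠ 0 :=
    mul_ne_zero (mul_ne_zero h2' (hv 2)) (hpm 1 0 (by decide)).1
  have d4 : 2 * v W h2 2 * (v W h2 0 - v W h2 1) ≠ 0 :=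
    mul_ne_zero (mul_ne_zero h2' (hv 2)) (hpm 0 1 (by decide)).2
  have d5 : 2 * v W h2 0 * (v W h2 2 - v W h2 1) ≠ 0 :=
    mul_ne_zero (mul_ne_zero h2' (hv 0)) (hpm 2 1 (by decide)).2
  have d6 : 2 * v W h2 1 * (v W h2 2 - v W h2 0) ≠ 0 :=
    mul_ne_zero (mul_ne_zero h2' (hv 1)) (hpm 2 0 (by decide)).2
  have hw : ∀ η : ZMod 2 × ZMod 2, w W h2 η =
      (sgnUnit (etaf η 0) : AlgebraicClosure K) * (v W h2 1 * v W h2 2) +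
        (sgnUnit (etaf η 1) : AlgebraicClosure K) * (v W h2 2 * v W h2 0) +
        (sgnUnit (etaf η 2) : AlgebraicClosure K) * (v W h2 0 * v W h2 1) := by
    intro η
    rw [w, Fin.sum_univ_three]
    rfl
  intro η η' h
  rw [hw, hw] at h
  revert η η'
  have hs : ∀ η : ZMod 2 × ZMod 2, η = (0, 0) ∨ η = (1, 0) ∨ η = (0, 1) ∨ η = (1, 1) := by decide
  have h11 : (1 : ZMod 2) + 1 = 0 := by decide
  intro η η' h
  rcases hs η with rfl | rfl | rfl | rfl <;> rcases hs η' with rfl | rfl | rfl | rfl <;>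
    simp only [etaf, Matrix.cons_val_zero, Matrix.cons_val_one, Matrix.cons_val, sgnUnit_zero,
      sgnUnit_one, Int.cast_one, Int.cast_neg, zero_add, add_zero, h11] at h ⊢ <;>
    first
    | rfl
    | exact absurd (by linear_combination h) d1
    | exact absurd (by linear_combination -h) d1
    | exact absurd (by linear_combination h) d2
    | exact absurd (by linear_combination -h) d2
    | exact absurd (by linear_combination h) d3
    | exact absurd (by linear_combination -h) d3
    | exact absurd (by linear_combination h) d4
    | exact absurd (by linear_combination -h) d4
    | exact absurd (by linear_combination h) d5
    | exact absurd (by linear_combination -h) d5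
    | exact absurd (by linear_combination h) d6
    | exact absurd (by linear_combination -h) d6

/-! ### §4. The dictionary with the matrices `ρ̄₄(σ)` -/

/-- The parity labels `w̄_i`, stored as the first column of a parity tuple (bookkeeping). [folklore] -/
def wbarP : Fin 3 → P4 := ![(1, 0, 0, 0), (0, 0, 1, 0), (1, 0, 1, 0)]

/-- "The parity `p ∈ GL₂(𝔽₂)` fixes the nonzero vector `w̄_i` of `𝔽₂²`" (bookkeeping predicate for
`GL₂(𝔽₂) ≅ S₃` acting on `E[2] ∖ O`). [cite: DokchitserDokchitserMathZ2012, proof of the Theorem (ρ̄₂ and GL₂(𝔽₂) ≅ S₃)] -/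
def FixesP (p : P4) (i : Fin 3) : Prop :=
  (P4.mul p (wbarP i)).1 = (wbarP i).1 ∧ (P4.mul p (wbarP i)).2.2.1 = (wbarP i).2.2.1

/-- `2 • (N w_i) = 2 • w_i` in `(ℤ/4)²` is the parity statement "`N̄` fixes `w̄_i`" (`E[2] = 2E[4]`,
the action on `E[2]` is reduction mod `2`). [cite: SilvermanAEC2009, III.7 (the Galois action on E[2] ⊂ E[4])] -/
theorem two_nsmul_mulVec_wvec_eq_iff (N : M4) (i : Fin 3) :
    2 • (N *ᵥ wvec i) = 2 • wvec i ↔ FixesP (par N) i := by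
  have key0 : ∀ x : ZMod 4, 2 * x = 0 ↔ red x = 0 := by decide
  have key1 : ∀ x : ZMod 4, 2 * x = 2 ↔ red x = 1 := by decide
  have key2 : ∀ x y : ZMod 4, 2 * x + 2 * y = 2 ↔ red x + red y = 1 := by decide
  rw [FixesP, funext_iff, Fin.forall_fin_two]
  fin_cases i <;>
    simp [Matrix.mulVec, dotProduct, Fin.sum_univ_two, Pi.single_apply, nsmul_eq_mul, par, Q4.par,
      tup, P4.mul, wbarP, key0, key1, key2]

/-- Which parities of determinant `1` fix which labels: the identity fixes all three, the two
`3`-cycles `ω̄, ω̄²` fix none (`GL₂(𝔽₂) ≅ S₃` on the three nonzero vectors).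
[cite: DokchitserDokchitserMathZ2012, proof of the Theorem (GL₂(𝔽₂) ≅ S₃)] -/
theorem fixesP_facts : ∀ p : P4, P4.det p = 1 →
    ((∀ i, FixesP p i) ↔ p = (1, 0, 0, 1)) ∧
      ((∀ i, ¬ FixesP p i) ↔ (p = (0, 1, 1, 1) ∨ p = (1, 1, 1, 0))) := by
  unfold FixesP; decide

/-- **`π_σ i = i` iff the parity of `ρ̄₄(σ)` fixes `w̄_i`.** [cite: SilvermanAEC2009, III.7 (the Galois action on E[2] ⊂ E[4])] -/
theorem pi_apply_eq_iff (σ : Field.absoluteGaloisGroup K) (i : Fin 3) :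
    pi W h2 σ i = i ↔ FixesP (par (M W h2 σ)) i := by
  rw [← (letter_injective W h2).eq_iff, letter_pi, permGal_letter_eq_iff,
    two_nsmul_mulVec_wvec_eq_iff]

/-- **`π_σ = 1` iff `ρ̄₄(σ) ≡ 1 (mod 2)`.** [cite: SilvermanAEC2009, III.7 (the Galois action on E[2] ⊂ E[4])] -/
theorem pi_eq_one_iff (σ : Field.absoluteGaloisGroup K) :
    pi W h2 σ = 1 ↔ par (M W h2 σ) = (1, 0, 0, 1) := by
  rw [← ((fixesP_facts _ (par_det_one (rhoMat W (frame4 W h2)) σ)).1), Equiv.ext_iff]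
  exact forall_congr' fun i ↦ pi_apply_eq_iff W h2 σ i

/-- **`π_σ` is fixed-point-free iff `ρ̄₄(σ) mod 2` is a `3`-cycle** (`ω̄` or `ω̄²`).
[cite: SilvermanAEC2009, III.7 (the Galois action on E[2] ⊂ E[4])] -/
theorem pi_ne_forall_iff (σ : Field.absoluteGaloisGroup K) :
    (∀ i, pi W h2 σ i ≠ i) ↔ (par (M W h2 σ) = (0, 1, 1, 1) ∨ par (M W h2 σ) = (1, 1, 1, 0)) := by
  rw [← ((fixesP_facts _ (par_det_one (rhoMat W (frame4 W h2)) σ)).2)]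
  exact forall_congr' fun i ↦ not_congr (pi_apply_eq_iff W h2 σ i)

/-- The columns `N w₀, N w₁, N w₂ = N w₀ + N w₁` as pairs of entries (bookkeeping). [folklore] -/
def colv (N : M4) : Fin 3 → ZMod 4 × ZMod 4 :=
  ![(N 0 0, N 1 0), (N 0 1, N 1 1), (N 0 0 + N 0 1, N 1 0 + N 1 1)]

/-- `N w_i = u` componentwise. [folklore] -/
private theorem mulVec_wvec_eq_iff (N : M4) (i : Fin 3) (u : Fin 2 → ZMod 4) :
    N *ᵥ wvec i = u ↔ (colv N i).1 = u 0 ∧ (colv N i).2 = u 1 := by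
  rw [funext_iff, Fin.forall_fin_two]
  fin_cases i <;> simp [Matrix.mulVec, dotProduct, Fin.sum_univ_two, Pi.single_apply, colv]

/-- The entries of `N` from its tuple. [folklore] -/
private theorem entries_of_tup_eq {N : M4} {a b c d : ZMod 4} (h : tup N = (a, b, c, d)) :
    N 0 0 = a ∧ N 0 1 = b ∧ N 1 0 = c ∧ N 1 1 = d := by
  simp only [tup, Prod.mk.injEq] at h
  exact ⟨h.1, h.2.1, h.2.2.1, h.2.2.2⟩

/-- **The matrices `±1, ±(1 + 2w₀)` act trivially on the classes**: their `π` is `1` and their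
signs are constant (`(0,0,0)` for `±1`, `(1,1,1)` for `±(1 + 2w₀)`).
[cite: DokchitserDokchitserMathZ2012, proof of Theorem (2) (the subgroup ℍ; its elements ≡ 1 mod 2)] -/
theorem actE_eq_self_of_tup_mem_four (σ : Field.absoluteGaloisGroup K)
    (h : tup (M W h2 σ) = (1, 0, 0, 1) ∨ tup (M W h2 σ) = (3, 0, 0, 3) ∨
      tup (M W h2 σ) = (1, 2, 2, 3) ∨ tup (M W h2 σ) = (3, 2, 2, 1))
    (η : ZMod 2 × ZMod 2) : actE (pi W h2 σ) (sgnH W h2 σ) η = η := by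
  have hpar : par (M W h2 σ) = (1, 0, 0, 1) := by
    rcases h with h | h | h | h <;> rw [par, h] <;> decide
  have hpi : pi W h2 σ = 1 := (pi_eq_one_iff W h2 σ).mpr hpar
  -- the signs are constant
  have hconst : ∃ c : ZMod 2, sgnH W h2 σ = fun _ ↦ c := by
    rcases h with h | h | h | h <;> obtain ⟨ha, hb, hc, hd⟩ := entries_of_tup_eq h
    · refine ⟨0, funext fun i ↦ ?_⟩
      rw [sgnH, hpi, Equiv.Perm.one_apply, if_pos]
      left
      rw [mulVec_wvec_eq_iff]
      fin_cases i <;> simp [colv, ha, hb, hc, hd]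
    · refine ⟨0, funext fun i ↦ ?_⟩
      rw [sgnH, hpi, Equiv.Perm.one_apply, if_pos]
      right
      rw [mulVec_wvec_eq_iff]
      fin_cases i <;> simp [colv, ha, hb, hc, hd] <;> decide
    · refine ⟨1, funext fun i ↦ ?_⟩
      rw [sgnH, hpi, Equiv.Perm.one_apply, if_neg]
      rw [mulVec_wvec_eq_iff, mulVec_wvec_eq_iff]
      fin_cases i <;> simp [colv, ha, hb, hc, hd] <;> decide
    · refine ⟨1, funext fun i ↦ ?_⟩
      rw [sgnH, hpi, Equiv.Perm.one_apply, if_neg]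
      rw [mulVec_wvec_eq_iff, mulVec_wvec_eq_iff]
      fin_cases i <;> simp [colv, ha, hb, hc, hd] <;> decide
  obtain ⟨c, hc⟩ := hconst
  rw [hpi, hc]
  exact actE_one_const c η

/-- **`diag(3, 1)` moves every class**: `π = 1`, signs `(0, 0, 1)` (`3w₀ = -w₀`, `w₁`, but
`3w₀ + w₁ ≠ ±(w₀ + w₁)`). [cite: DokchitserDokchitserMathZ2012, Lemma (p. 962), proof (the stabiliser of θ_ℍ is precisely ℍ)] -/
theorem actE_diag_ne_self (σ : Field.absoluteGaloisGroup K) (h : tup (M W h2 σ) = (3, 0, 0, 1))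
    (η : ZMod 2 × ZMod 2) : actE (pi W h2 σ) (sgnH W h2 σ) η ≠ η := by
  have hpar : par (M W h2 σ) = (1, 0, 0, 1) := by rw [par, h]; decide
  have hpi : pi W h2 σ = 1 := (pi_eq_one_iff W h2 σ).mpr hpar
  obtain ⟨ha, hb, hc, hd⟩ := entries_of_tup_eq h
  have hs : sgnH W h2 σ = ![0, 0, 1] := by
    funext i
    rw [sgnH, hpi, Equiv.Perm.one_apply]
    fin_cases i
    · rw [if_pos]
      · rfl
      right
      rw [mulVec_wvec_eq_iff]
      simp [colv, ha, hc]; decide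
    · rw [if_pos]
      · rfl
      left
      rw [mulVec_wvec_eq_iff]
      simp [colv, hb, hd]
    · rw [if_neg]
      · rfl
      rw [mulVec_wvec_eq_iff, mulVec_wvec_eq_iff]
      simp [colv, ha, hb, hc, hd]; decide
  rw [hpi, hs]
  exact actE_one_single_ne η

end LevelFour

end Literature.NumberTheory.EllipticCurves.DokchitserDokchitser2012

end
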